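import Literature.Probability.RandomPlanarGeometry.SAWPatternWeightedAutomata
import Literature.Probability.RandomPlanarGeometry.SAWFiniteMemorySymm
import HarnessLib

/-!
# Local patterns read by the Pönitz–Tittmann automaton: turns and tight U-turns

Topic `Literature/Probability/RandomPlanarGeometry` (continues `SAWFiniteMemorySymm.lean` and
`SAWPatternWeightedAutomata.lean`). To tilt the self-avoiding count by the number of occurrences of
a LOCAL PATTERN — a turn (two consecutive steps differ) or a tight U-turn (the pattern `(e, f, -e)`,
the tree's `Zd.hairpinAt`) — the weight of a letter must be read off the letters just before it.
The memory-`K` automaton `ptStep K` of Pönitz–Tittmann keeps, for `K ≥ 4`, at least the last two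
letters of every input it has not killed (`two_le_length_ptStep`, `lastTwo_run`): the two most
recent vertices always pass the closability test `|suffix| + ‖·‖₁ ≤ 4 ≤ K`. Hence the
state-dependent weight `patW sel p q a d` (`p` if the letter `d` completes the pattern after the
state `a`, else `q`) multiplies along a self-avoiding word `w` to `p^{#pat(w)} q^{|w| - #pat(w)}`
(`wprodS_patW_eq`), and the pattern events are invariant under the eight lattice symmetries
(`patW_map`), so the symmetry-reduced certificate of `SAWFiniteMemorySymm.lean` carries over
(`SAWPatternFiniteMemoryCheck.lean`).

## Contents (namespace `Literature.Probability.RandomPlanarGeometry.SAW.FiniteMemory`)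

* `lastTwo a` (the last two letters, most recent first); `lastTwo_of_suffix`, `lastTwo_map`,
  `lastTwo_append_singleton`;
* `scanl_eq_map_range`, `getElem?_pVerts`, `length_takeWhile_le_of_neg` (list lemmas);
* **`two_le_length_ptStep`** (`K ≥ 4`: the new state has `≥ min(2, |a|+1)` letters),
  `lastTwo_ptStep`, **`lastTwo_run`**;
* `turnSel`, `uturnSel`, `patSel`, `patW`; invariance `patW_map`;
* `patCount sel w` (number of letters completing the pattern), `patCount_append_singleton`,
  `patCount_le_length`, **`wprodS_patW_eq`**.

## References

* A. Pönitz, P. Tittmann, *Improved upper bounds for self-avoiding walks in ℤᵈ*, Electron. J.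
  Combin. 7 (2000) R21, §2 (the automaton: "the longest suffix that can still be closed to a loop
  of length at most k"), §3 [PonitzTittmann2000].
* N. Madras, G. Slade, *The Self-Avoiding Walk* (1993), §7.1–7.2 (patterns; Kesten's pattern
  theorem, Theorem 7.2.3) [MadrasSlade1993].
-/

open Finset Literature.Probability.LatticeModels
open scoped BigOperators

namespace Literature.Probability.RandomPlanarGeometry.SAW

namespace FiniteMemory

/-! ### The last two letters of a word -/

/-- The last two letters of a word, most recent first (fewer if the word is shorter).
[cite: PonitzTittmann2000, §2] -/
def lastTwo (a : List Step) : List Step := a.reverse.take 2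

/-- `lastTwo [] = []`. [cite: PonitzTittmann2000, §2] -/
@[simp] theorem lastTwo_nil : lastTwo [] = [] := rfl

/-- A suffix of length `≥ 2` has the same last two letters. [cite: PonitzTittmann2000, §2] -/
theorem lastTwo_of_suffix {b l : List Step} (h : b <:+ l) (hb : 2 ≤ b.length) :
    lastTwo b = lastTwo l := by
  obtain ⟨t, rfl⟩ := h
  rw [lastTwo, lastTwo, List.reverse_append, List.take_append_of_le_length (by simpa using hb)]

/-- A suffix of length `≥ min(2, |l|)` has the same last two letters. [cite: PonitzTittmann2000, §2] -/
theorem lastTwo_of_suffix' {b l : List Step} (h : b <:+ l) (hb : min 2 l.length ≤ b.length) :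
    lastTwo b = lastTwo l := by
  rcases le_or_gt 2 l.length with hl | hl
  · exact lastTwo_of_suffix h (by rw [min_eq_left hl] at hb; exact hb)
  · have hle : l.length ≤ b.length := le_trans (by rw [min_eq_right hl.le]) hb
    rw [h.eq_of_length (le_antisymm h.length_le hle)]

/-- `lastTwo` commutes with relabelling the letters. [cite: PonitzTittmann2000, §3] -/
theorem lastTwo_map (g : Step → Step) (a : List Step) : lastTwo (a.map g) = (lastTwo a).map g := by
  rw [lastTwo, lastTwo, ← List.map_reverse, List.map_take]

/-- Appending a letter: `lastTwo (l ++ [d]) = d :: (lastTwo l).take 1`. [cite: PonitzTittmann2000, §2] -/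
theorem lastTwo_append_singleton (l : List Step) (d : Step) :
    lastTwo (l ++ [d]) = d :: (lastTwo l).take 1 := by
  rw [lastTwo, lastTwo, List.reverse_append, List.reverse_singleton, List.singleton_append,
    List.take_succ_cons, List.take_take, min_eq_left (by norm_num : 1 ≤ 2)]

/-! ### List lemmas: `scanl` as a map over prefixes; vertices of a state; `takeWhile` -/

/-- `scanl f b l` lists the folds of the prefixes of `l`. [folklore] -/
private theorem scanl_eq_map_range {α β : Type*} (f : β → α → β) (b : β) (l : List α) :
    List.scanl f b l = (List.range (l.length + 1)).map fun i => List.foldl f b (l.take i) := by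
  induction l generalizing b with
  | nil => simp
  | cons x l ih =>
    rw [List.scanl_cons, ih, List.length_cons]
    conv_rhs => rw [List.range_succ_eq_map, List.map_cons, List.map_map]
    rfl

/-- The number of vertices of a state. [folklore] -/
private theorem length_pVerts (a : List Step) : (pVerts a).length = a.length + 1 := by
  rw [pVerts, List.length_scanl]

/-- `toPair 0 = (0, 0)`. [folklore] -/
@[simp] private theorem toPair_zero : toPair 0 = (0, 0) := rfl

/-- The `i`-th vertex of a state in pair coordinates is `toPair (traj a i)`. [folklore] -/
private theorem getElem?_pVerts (a : List Step) {i : ℕ} (hi : i ≤ a.length) :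
    (pVerts a)[i]? = some (toPair (traj a i)) := by
  rw [pVerts, scanl_eq_map_range, List.getElem?_map, List.getElem?_range (by omega), Option.map_some]
  congr 1
  have := foldl_pxy_eq (a.take i) 0
  rw [zero_add, toPair_zero] at this
  rw [this, traj]

/-- If the `i`-th element fails the predicate, `takeWhile` stops at or before it. [folklore] -/
private theorem length_takeWhile_le_of_neg {α : Type*} (p : α → Bool) (l : List α) {i : ℕ}
    (hi : i < l.length) (h : p (l[i]) = false) : (l.takeWhile p).length ≤ i := by
  induction l generalizing i with
  | nil => simp at hi
  | cons x l ih =>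
    rw [List.takeWhile_cons]
    cases i with
    | zero =>
      simp only [List.getElem_cons_zero] at h
      simp [h]
    | succ i =>
      simp only [List.getElem_cons_succ] at h
      split
      · simpa using ih (by simpa using hi) h
      · simp

/-- Two unit steps move a point by at most `2` in `ℓ¹`. [folklore] -/
private theorem dist1_pxy_pxy_le (p : ℤ × ℤ) (s d : Step) : dist1 p (pxy d (pxy s p)) ≤ 2 := by
  obtain ⟨x, y⟩ := p
  fin_cases s <;> fin_cases d <;> simp [dist1, pxy, Step.dx, Step.dy] <;> omega

/-- One unit step moves a point by at most `2` in `ℓ¹`. [folklore] -/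
private theorem dist1_pxy_le (p : ℤ × ℤ) (d : Step) : dist1 p (pxy d p) ≤ 2 := by
  obtain ⟨x, y⟩ := p
  fin_cases d <;> simp [dist1, pxy, Step.dx, Step.dy]

/-! ### The memory-`K` automaton keeps the last two letters (`K ≥ 4`) -/

/-- **The new state of the Pönitz–Tittmann automaton has at least `min(2, |a|+1)` letters** when
`K ≥ 4`: the vertex two steps before the new endpoint passes the closability test
`(#steps after it) + ‖it - endpoint‖₁ ≤ 2 + 2 ≤ K`, so the kept suffix starts at or before it.
[cite: PonitzTittmann2000, §2] -/
theorem two_le_length_ptStep {K : ℕ} (hK : 4 ≤ K) {a b : List Step} {d : Step}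
    (h : ptStep K a d = some b) : min 2 (a.length + 1) ≤ b.length := by
  unfold ptStep at h
  simp only at h
  split_ifs at h with hmem
  rw [Option.some.injEq] at h
  subst h
  rw [List.length_drop, List.length_append, List.length_singleton]
  -- the index `i₀ = |a| - 1` fails the test
  have hZlen : ((pVerts a).zipIdx).length = a.length + 1 := by rw [List.length_zipIdx, length_pVerts]
  have hi₀Z : a.length - 1 < ((pVerts a).zipIdx).length := by rw [hZlen]; omega
  have hi₀V : a.length - 1 < (pVerts a).length := by rw [length_pVerts]; omega
  have hvert : (pVerts a)[a.length - 1] = toPair (traj a (a.length - 1)) := by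
    have h1 := getElem?_pVerts a (Nat.sub_le a.length 1)
    rw [List.getElem?_eq_getElem hi₀V, Option.some.injEq] at h1
    exact h1
  have hZi : ((pVerts a).zipIdx)[a.length - 1] = (toPair (traj a (a.length - 1)), a.length - 1) := by
    rw [List.getElem_zipIdx, hvert, zero_add]
  -- distance from that vertex to the new endpoint is ≤ 2
  have hdist : dist1 (toPair (traj a (a.length - 1))) (pxy d (pEnd a)) ≤ 2 := by
    rw [pEnd_eq, ← traj_length]
    rcases Nat.eq_zero_or_pos a.length with h0 | hpos
    · have : a.length - 1 = 0 := by rw [h0]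
      rw [this, h0, traj_zero, toPair_zero]
      exact dist1_pxy_le _ _
    · have hlt : a.length - 1 < a.length := by omega
      conv_lhs => rw [show a.length = (a.length - 1) + 1 by omega]
      rw [traj_succ a hlt, toPair_add_vec]
      exact dist1_pxy_pxy_le _ _ _
  have hfail : (fun pi : (ℤ × ℤ) × ℕ => decide (K < a.length + 1 - pi.2 + dist1 pi.1 (pxy d (pEnd a))))
      (((pVerts a).zipIdx)[a.length - 1]) = false := by
    rw [hZi]
    simp only [decide_eq_false_iff_not, not_lt]
    omega
  have hj := length_takeWhile_le_of_neg
    (fun pi : (ℤ × ℤ) × ℕ => decide (K < a.length + 1 - pi.2 + dist1 pi.1 (pxy d (pEnd a)))) _ hi₀Z hfail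
  omega

/-- The new state has the same last two letters as the old state with the letter appended
(`K ≥ 4`). [cite: PonitzTittmann2000, §2] -/
theorem lastTwo_ptStep {K : ℕ} (hK : 4 ≤ K) {a b : List Step} {d : Step}
    (h : ptStep K a d = some b) : lastTwo b = lastTwo (a ++ [d]) :=
  lastTwo_of_suffix' (ptStep_suffix h) (by
    have := two_le_length_ptStep hK h
    rw [List.length_append, List.length_singleton]; exact this)

/-- **A live run of the memory-`K` automaton (`K ≥ 4`) ends in a state with the last two letters of
the word read.** [cite: PonitzTittmann2000, §2] -/
theorem lastTwo_run {K : ℕ} (hK : 4 ≤ K) (w : List Step) {a : List Step}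
    (h : WordAutomaton.run (ptStep K) w = some a) : lastTwo a = lastTwo w := by
  induction w using List.reverseRecOn generalizing a with
  | nil => simp only [WordAutomaton.run_nil, Option.some.injEq] at h; rw [← h]
  | append_singleton w d ih =>
    rw [WordAutomaton.run_append_singleton] at h
    cases hw : WordAutomaton.run (ptStep K) w with
    | none => simp [hw] at h
    | some a' =>
      rw [hw, Option.bind_some] at h
      rw [lastTwo_ptStep hK h, lastTwo_append_singleton, lastTwo_append_singleton, ih hw]

/-! ### Pattern selectors and state-dependent weights -/

/-- **Turn selector**: the new letter `d` differs from the last letter (read off `lastTwo`).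
[cite: MadrasSlade1993, §7.1] -/
def turnSel (l : List Step) (d : Step) : Bool :=
  match l with
  | e :: _ => decide (e ≠ d)
  | [] => false

/-- **Tight U-turn selector**: the new letter `d` is opposite to the letter before last,
`d = e + 2` on `Fin 4` (the pattern `(e, f, -e)` of `Zd.hairpinAt`). [cite: MadrasSlade1993, §7.1] -/
def uturnSel (l : List Step) (d : Step) : Bool :=
  match l with
  | _ :: e :: _ => decide (d = e + 2)
  | _ => false

/-- Pattern selector by number: `0` = turn, otherwise tight U-turn. [cite: MadrasSlade1993, §7.1] -/
def patSel (sel : ℕ) : List Step → Step → Bool := if sel = 0 then turnSel else uturnSel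

/-- **Pattern-tilted letter weight**: `p` if the letter completes the pattern after the state `a`,
else `q` (tilt `t = p/q`, cleared of denominators). [cite: PonitzTittmann2000, §3] -/
def patW (sel p q : ℕ) (a : List Step) (d : Step) : ℕ := if patSel sel (lastTwo a) d then p else q

/-- `patW` depends on the state only through its last two letters. [cite: PonitzTittmann2000, §3] -/
theorem patW_congr (sel p q : ℕ) {a a' : List Step} (h : lastTwo a = lastTwo a') (d : Step) :
    patW sel p q a d = patW sel p q a' d := by
  rw [patW, patW, h]

/-- The symmetries are injective on the step alphabet (pointwise form). [folklore] -/
private theorem syms_inj : ∀ g ∈ syms, ∀ e d : Step, (g e = g d ↔ e = d) := by decide +kernel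

/-- The symmetries commute with reversal `d ↦ d + 2` (pointwise form). [folklore] -/
private theorem syms_opp : ∀ g ∈ syms, ∀ e d : Step, (g d = g e + 2 ↔ d = e + 2) := by decide +kernel

/-- The turn selector is invariant under the lattice symmetries. [cite: PonitzTittmann2000, §3] -/
theorem turnSel_map {g : Step → Step} (hg : g ∈ syms) (l : List Step) (d : Step) :
    turnSel (l.map g) (g d) = turnSel l d := by
  cases l with
  | nil => rfl
  | cons e l => simp only [turnSel, List.map_cons, ne_eq, syms_inj g hg]

/-- The tight-U-turn selector is invariant under the lattice symmetries. [cite: PonitzTittmann2000, §3] -/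
theorem uturnSel_map {g : Step → Step} (hg : g ∈ syms) (l : List Step) (d : Step) :
    uturnSel (l.map g) (g d) = uturnSel l d := by
  match l with
  | [] => rfl
  | [_] => rfl
  | _ :: e :: l => simp only [uturnSel, List.map_cons, syms_opp g hg]

/-- The pattern selectors are invariant under the lattice symmetries. [cite: PonitzTittmann2000, §3] -/
theorem patSel_map {g : Step → Step} (hg : g ∈ syms) (sel : ℕ) (l : List Step) (d : Step) :
    patSel sel (l.map g) (g d) = patSel sel l d := by
  unfold patSel; split_ifs
  · exact turnSel_map hg l d
  · exact uturnSel_map hg l d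

/-- **The pattern weight is invariant under the lattice symmetries**:
`patW (g·a) (g d) = patW a d`. [cite: PonitzTittmann2000, §3] -/
theorem patW_map {g : Step → Step} (hg : g ∈ syms) (sel p q : ℕ) (a : List Step) (d : Step) :
    patW sel p q (a.map g) (g d) = patW sel p q a d := by
  rw [patW, patW, lastTwo_map, patSel_map hg]

/-! ### The number of pattern occurrences of a word and the weight of a self-avoiding word -/

/-- **The number of letters of `w` completing the pattern**: indices `i < |w|` whose letter `w_i`
completes the pattern after the prefix `w[0, i)` (a turn at `i ≥ 1`: `w_i ≠ w_{i-1}`; a tight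
U-turn at `i ≥ 2`: `w_i = -w_{i-2}`). [cite: MadrasSlade1993, §7.1] -/
def patCount (sel : ℕ) (w : List Step) : ℕ :=
  ((range w.length).filter fun i => patSel sel (lastTwo (w.take i)) (w.getD i 0) = true).card

/-- `patCount` of the empty word. [cite: MadrasSlade1993, §7.1] -/
@[simp] theorem patCount_nil (sel : ℕ) : patCount sel [] = 0 := by simp [patCount]

/-- `patCount ≤ |w|`. [cite: MadrasSlade1993, §7.1] -/
theorem patCount_le_length (sel : ℕ) (w : List Step) : patCount sel w ≤ w.length := by
  rw [patCount]
  exact (card_filter_le _ _).trans (card_range _).le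

/-- Appending a letter adds one occurrence iff the letter completes the pattern. [cite: MadrasSlade1993, §7.1] -/
theorem patCount_append_singleton (sel : ℕ) (w : List Step) (d : Step) :
    patCount sel (w ++ [d]) = patCount sel w + if patSel sel (lastTwo w) d then 1 else 0 := by
  rw [patCount, patCount, List.length_append, List.length_singleton, range_add_one, filter_insert]
  have hlast : (w ++ [d]).take w.length = w := by simp
  have hgetD : (w ++ [d]).getD w.length 0 = d := by simp
  have hset : ((range w.length).filter fun i =>
      patSel sel (lastTwo ((w ++ [d]).take i)) ((w ++ [d]).getD i 0) = true) =
      (range w.length).filter fun i => patSel sel (lastTwo (w.take i)) (w.getD i 0) = true := by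
    refine filter_congr fun i hi => ?_
    rw [mem_range] at hi
    rw [List.take_append_of_le_length hi.le, List.getD_eq_getElem?_getD, List.getD_eq_getElem?_getD,
      List.getElem?_append_left hi]
  rw [hlast, hgetD, hset]
  split_ifs with h
  · rw [card_insert_of_notMem (by simp)]
  · simp

/-- **The pattern-tilted weight of a self-avoiding word**: along the run of the memory-`K`
automaton (`K ≥ 4`), `wprodS (patW sel p q) w = p^{#pat(w)} · q^{|w| - #pat(w)}`.
[cite: PonitzTittmann2000, §3] -/
theorem wprodS_patW_eq {K : ℕ} (hK : 4 ≤ K) (sel p q : ℕ) {w : List Step} (hw : IsSAW w) :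
    WordAutomaton.wprodS (ptStep K) (patW sel p q) w =
      p ^ patCount sel w * q ^ (w.length - patCount sel w) := by
  induction w using List.reverseRecOn with
  | nil => simp
  | append_singleton w d ih =>
    have hw' : IsSAW w := by simpa using hw.take w.length
    obtain ⟨a, ha, -⟩ := run_eq_some_of_isSAW K w hw'
    rw [WordAutomaton.wprodS_append_singleton_of_run ha, ih hw', patW_congr sel p q (lastTwo_run hK w ha),
      patCount_append_singleton, List.length_append, List.length_singleton, patW]
    have hc := patCount_le_length sel w
    split_ifs with h
    · rw [show w.length + 1 - (patCount sel w + 1) = w.length - patCount sel w by omega, pow_succ]; ring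
    · rw [add_zero, show w.length + 1 - patCount sel w = (w.length - patCount sel w) + 1 by omega, pow_succ]
      ring

end FiniteMemory

end Literature.Probability.RandomPlanarGeometry.SAW
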